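import Summits.Ventures.PercRepro.SixFourPLLines

/-!
# PercRepro — C-025 at `(6,4)`, §22.12.4 step (2): the bonus term of a plane-line set (p3, gen 9)

mine-2's `MINE2-RLS.md` 22.12.4 (2): `Σ_{lines} bonus(m_ℓ) ≥ Σ_m b_m(π)·bonus(m)`.  With the line counts
`b_m(π) = [m = n + e] + inc_m + [m = 2]·n(p − e)` of `SixFourPLList.lean` and `bonus(2) = 0`, the right side is
`bonus(n + e) + Σ_{m ≥ 2} inc_m·bonus(m)`: the line `ℓ` has trace `n + e` on `G`, a line of `M` meeting `ρ` in
`m ≥ 2` points meets `G` in exactly those `m` points (`not_line_through_L_and_two_of_ρ`) and is not `ℓ`, and every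
other term of the left side is `≥ 0`.

* `bonus5_eq`: `5·bonus(m) = bonus5(m)` (the two `δ`'s agree);
* `card_inter_G_eq_of_two_le`: a line with `≥ 2` points of `ρ` has `|L′ ∩ G| = |L′ ∩ ρ|`;
* **`bonus5sum_profile_le`**: `(bonus5sum (profile D) : ℚ) ≤ 5 · Σ_{L ∈ lines M} bonus (L ∩ G).card`.
-/

namespace PercRepro.SixFour

open Finset ThmH

variable {α : Type*} [DecidableEq α] {M : Matroid α} [M.Finite] {G : Finset α}

/-- `PL.ch` is `Nat.choose`. -/
theorem PLch_eq_choose (n k : ℕ) : PL.ch n k = n.choose k := by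
  unfold PL.ch
  split_ifs with h
  · exact (Nat.choose_eq_factorial_div_factorial h).symm
  · exact (Nat.choose_eq_zero_of_lt (not_le.1 h)).symm

/-- The two `δ`'s agree. -/
theorem PLdelta_eq (m : ℕ) : PL.delta m = PercRepro.SixFour.delta m := by
  unfold PL.delta PercRepro.SixFour.delta S3
  rw [PLch_eq_choose, PLch_eq_choose]
  omega

/-- `bonus5 m = 5·bonus m`. -/
theorem bonus5_eq (m : ℕ) : (PL.bonus5 m : ℚ) = 5 * bonus m := by
  unfold PL.bonus5 bonus
  rw [PLdelta_eq, PLch_eq_choose]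
  push_cast
  ring

/-- `bonus m ≥ 0`. -/
theorem bonus_nonneg (m : ℕ) : 0 ≤ bonus m := by
  unfold bonus
  positivity

/-- `bonus5 2 = 0`. -/
theorem bonus5_two : PL.bonus5 2 = 0 := by decide

namespace PLData

variable {D : PLData M G}

/-- A line of `M` with at least two points of `ρ` meets `G` exactly in its points of `ρ`. -/
theorem inter_G_eq_inter_ρ_of_two_le (hs : Simple M) {L' : Finset α} (hL' : L' ∈ lines M)
    (h2 : 2 ≤ (L' ∩ D.ρ).card) : L' ∩ G = L' ∩ D.ρ := by
  obtain ⟨a, ha, b, hb, hab⟩ := Finset.one_lt_card.1 h2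
  apply Finset.Subset.antisymm
  · intro z hz
    rw [Finset.mem_inter] at hz ⊢
    refine ⟨hz.1, ?_⟩
    by_contra hzρ
    have hzL : z ∈ L' ∩ D.L := by
      rw [Finset.mem_inter]
      refine ⟨hz.1, Finset.mem_sdiff.2 ⟨hz.2, fun hzP => hzρ ?_⟩⟩
      unfold ρ
      exact Finset.mem_inter.2 ⟨hzP, hz.2⟩
    exact not_line_through_L_and_two_of_ρ hs hL' hzL ha hb hab
  · exact Finset.inter_subset_inter (Finset.Subset.refl _) D.ρ_subset

/-- `ρ ⊆ P₀`. -/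
theorem ρ_subset_P₀ : D.ρ ⊆ D.P₀ := Finset.inter_subset_left

/-- A line of `M` with at least two points of `ρ` is not `ℓ`. -/
theorem ne_ellF_of_two_le (hs : Simple M) (hG : G ⊆ gr M) (h2 : 2 ≤ D.L.card) {L' : Finset α}
    (hL' : 2 ≤ (L' ∩ D.ρ).card) : L' ≠ D.ellF := by
  intro h
  rw [h] at hL'
  have hsub : D.ellF ∩ D.ρ ⊆ D.ellF ∩ D.P₀ :=
    Finset.inter_subset_inter (Finset.Subset.refl _) (ρ_subset_P₀ (D := D))
  have := (Finset.card_le_card hsub).trans (D.card_ellF_inter_le_one hs hG h2)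
  omega

/-- The trace of `ℓ` on `G` has `n + e` points. -/
theorem card_ellF_inter_G_eq (hs : Simple M) (hG : G ⊆ gr M) (h2 : 2 ≤ D.L.card) :
    (D.ellF ∩ G).card = PL.lprime D.profile := by
  rw [card_ellF_inter_G hs hG h2]
  unfold PL.lprime
  rw [e_profile_eq hs hG h2]
  rfl

/-- The profile's bonus sum in closed form: `bonus5sum π = bonus5 (n + e) + Σ_{m<8} inc_m·bonus5 m`
(the `n(p − e)` two-point lines carry `bonus5 2 = 0`; `bonus5 0 = bonus5 1 = 0`). -/
theorem bonus5sum_eq (hs : Simple M) (hG : G ⊆ gr M) (h2 : 2 ≤ D.L.card)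
    (hn6 : D.L.card + (D.ellF ∩ D.ρ).card ≤ 6) (h3 : 3 ≤ D.L.card) :
    PL.bonus5sum D.profile = PL.bonus5 (PL.lprime D.profile) +
      ∑ m ∈ Finset.range 8, (inc M D.ρ m : ℤ) * PL.bonus5 m := by
  have hl : PL.lprime D.profile = D.L.card + (D.ellF ∩ D.ρ).card := by
    unfold PL.lprime
    rw [e_profile_eq hs hG h2]
    rfl
  have hinc : ∀ m, 2 ≤ m → m ≤ 7 → PL.incOf D.profile m = inc M D.ρ m := by
    intro m hm2 hm7
    unfold PL.incOf
    rw [if_pos hm2, inc_profile (m - 2) (by omega), show m - 2 + 2 = m by omega]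
  have hb0 : PL.bonus5 0 = 0 := by decide
  have hb1 : PL.bonus5 1 = 0 := by decide
  have hb2 : PL.bonus5 2 = 0 := bonus5_two
  obtain ⟨l, hl'⟩ : ∃ l, PL.lprime D.profile = l := ⟨_, rfl⟩
  have hl3 : 3 ≤ l := by omega
  have hl6 : l ≤ 6 := by omega
  unfold PL.bonus5sum PL.b
  rw [hl']
  simp only [List.range_succ, List.range_zero, List.map_cons, List.map_nil, List.sum_cons, List.sum_nil,
    Nat.zero_add, List.nil_append, List.cons_append, Finset.sum_range_succ, Finset.sum_range_zero]
  rw [hinc 2 (by norm_num) (by norm_num), hinc 3 (by norm_num) (by norm_num), hinc 4 (by norm_num) (by norm_num),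
    hinc 5 (by norm_num) (by norm_num), hinc 6 (by norm_num) (by norm_num), hinc 7 (by norm_num) (by norm_num)]
  interval_cases l <;> simp [hb0, hb1, hb2] <;> ring

/-- **The bonus bound (22.12.4 (2))**: `bonus5sum (profile D) ≤ 5 · Σ_{L ∈ lines M} bonus (L ∩ G).card` — the
line `ℓ` contributes `bonus (n + e)`, the lines meeting `ρ` in `m ≥ 2` points contribute `inc_m · bonus m`, and every
other line contributes `≥ 0`. -/
theorem bonus5sum_profile_le (hs : Simple M) (hG : G ⊆ gr M) (h2 : 2 ≤ D.L.card)
    (hn6 : D.L.card + (D.ellF ∩ D.ρ).card ≤ 6) (h3 : 3 ≤ D.L.card) (hp7 : D.ρ.card ≤ 7) :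
    (PL.bonus5sum D.profile : ℚ) ≤ 5 * ∑ L ∈ lines M, bonus (L ∩ G).card := by
  classical
  have hℓ := (D.ellF_mem_lines hs hG h2).1
  rw [bonus5sum_eq hs hG h2 hn6 h3]
  push_cast
  rw [bonus5_eq]
  -- the right side, split at `ℓ` and at the lines with `≥ 2` points of `ρ`
  have hsplit : ∑ L ∈ lines M, bonus (L ∩ G).card =
      bonus (D.ellF ∩ G).card + ∑ L ∈ (lines M).erase D.ellF, bonus (L ∩ G).card :=
    (Finset.add_sum_erase _ _ hℓ).symm
  rw [hsplit, card_ellF_inter_G_eq hs hG h2]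
  -- the lines with `≥ 2` points of `ρ` (all in `(lines M).erase ℓ`) give the profile sum
  have hsub : ∑ L ∈ ((lines M).erase D.ellF).filter (fun L => 2 ≤ (L ∩ D.ρ).card), bonus (L ∩ G).card ≤
      ∑ L ∈ (lines M).erase D.ellF, bonus (L ∩ G).card :=
    Finset.sum_le_sum_of_subset_of_nonneg (Finset.filter_subset _ _) (fun L _ _ => bonus_nonneg _)
  have hfilt : ((lines M).erase D.ellF).filter (fun L => 2 ≤ (L ∩ D.ρ).card) =
      (lines M).filter (fun L => 2 ≤ (L ∩ D.ρ).card) := by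
    ext L
    rw [Finset.mem_filter, Finset.mem_filter, Finset.mem_erase]
    constructor
    · rintro ⟨⟨-, hL⟩, h⟩
      exact ⟨hL, h⟩
    · rintro ⟨hL, h⟩
      exact ⟨⟨ne_ellF_of_two_le hs hG h2 h, hL⟩, h⟩
  rw [hfilt] at hsub
  -- on those lines the trace on `G` is the trace on `ρ`, so the sum is `Σ_m inc_m · bonus m` over `m ≥ 2`
  have hval : ∑ L ∈ (lines M).filter (fun L => 2 ≤ (L ∩ D.ρ).card), bonus (L ∩ G).card =
      ∑ L ∈ (lines M).filter (fun L => 2 ≤ (L ∩ D.ρ).card), bonus (L ∩ D.ρ).card := by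
    refine Finset.sum_congr rfl (fun L hL => ?_)
    rw [Finset.mem_filter] at hL
    rw [inter_G_eq_inter_ρ_of_two_le hs hL.1 hL.2]
  -- the lines with `≤ 1` point of `ρ` contribute `bonus 0 = bonus 1 = 0`
  have hb0 : bonus 0 = 0 := by unfold bonus delta S3; norm_num
  have hb1 : bonus 1 = 0 := by unfold bonus delta S3; norm_num
  have hfull : ∑ L ∈ (lines M).filter (fun L => 2 ≤ (L ∩ D.ρ).card), bonus (L ∩ D.ρ).card =
      ∑ L ∈ lines M, bonus (L ∩ D.ρ).card := by
    apply Finset.sum_subset (Finset.filter_subset _ _)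
    intro L hL hnot
    rw [Finset.mem_filter] at hnot
    push Not at hnot
    have hc : (L ∩ D.ρ).card < 2 := hnot hL
    rcases (show (L ∩ D.ρ).card = 0 ∨ (L ∩ D.ρ).card = 1 by omega) with h | h <;> rw [h]
    · exact hb0
    · exact hb1
  -- group the lines by `|L ∩ ρ|`: `Σ_{m ≤ p} inc_m · bonus m`, then extend to `m < 8`
  have hall : ∑ L ∈ lines M, bonus (L ∩ D.ρ).card =
      ∑ m ∈ Finset.range (D.ρ.card + 1), (inc M D.ρ m : ℚ) * bonus m := by
    rw [← Finset.sum_fiberwise_of_maps_to' (g := fun L : Finset α => (L ∩ D.ρ).card)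
      (t := Finset.range (D.ρ.card + 1)) (fun L _ => by
        rw [Finset.mem_range]; exact Nat.lt_succ_of_le (Finset.card_le_card Finset.inter_subset_right))]
    refine Finset.sum_congr rfl (fun m _ => ?_)
    rw [Finset.sum_const, nsmul_eq_mul]
    rfl
  have hext : ∑ m ∈ Finset.range (D.ρ.card + 1), (inc M D.ρ m : ℚ) * bonus m =
      ∑ m ∈ Finset.range 8, (inc M D.ρ m : ℚ) * bonus m := by
    refine Finset.sum_subset (fun m hm => by rw [Finset.mem_range] at hm ⊢; omega) (fun m hm hnm => ?_)
    rw [Finset.mem_range] at hm hnm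
    rw [inc_eq_zero_of_card_le (eRk_ρ (D := D)) (by omega)]
    simp
  have hkey : ∑ m ∈ Finset.range 8, (inc M D.ρ m : ℚ) * bonus m ≤
      ∑ L ∈ (lines M).erase D.ellF, bonus (L ∩ G).card := by
    rw [← hext, ← hall, ← hfull, ← hval]
    exact hsub
  have hb5 : ∑ m ∈ Finset.range 8, (inc M D.ρ m : ℚ) * (PL.bonus5 m : ℚ) =
      5 * ∑ m ∈ Finset.range 8, (inc M D.ρ m : ℚ) * bonus m := by
    rw [Finset.mul_sum]
    refine Finset.sum_congr rfl (fun m _ => ?_)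
    rw [bonus5_eq]
    ring
  rw [hb5]
  linarith

end PLData

end PercRepro.SixFour
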